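import Mathlib.MeasureTheory.Integral.Indicator
import Mathlib.MeasureTheory.Measure.Portmanteau
import Summits.CriticalPhenomena.SAWScalingLimit.Theses.SAWRestrictionRigidity
import Literature.Probability.RandomPlanarGeometry.RadoContinuity

/-!
# Pinned-marks inner continuity of a chordal restriction family — partial regularity towards stub `stub_axiomsForceRado` (crux `Rigidity`, stmt-CriticalPhenomena-1368)

Target: `Summits/CriticalPhenomena/SAWScalingLimit/Theorems/SAWRestrictionRigidityRigidityPinnedInnerContinuity.lean`
(`--supports stmt-CriticalPhenomena-1368`; stub-worker of lead c7, line `registered`, reshape v4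
"dichotomy cut", stub `stub_axiomsForceRado` = "the seven lattice-exact axioms force Radó continuity
of `D ↦ P D`").

What the two-sided restriction property `ChordalFamily.IsRestriction` DOES give towards continuity of
`D ↦ P D` in the domain, with no Markov / reversal / symmetry input: for Dobrushin domains `Dₙ ⊆ D`
with the SAME marked points `a, b` (pinned marks),

* `tendsto_measure_of_eventually_rangeSubset` — if `P D`-almost every curve eventually stays in
  `closure Dₙ`, then `P Dₙ (T) → P D (T)` for every Borel `T` (setwise = total-variation convergence:
  `P Dₙ = P D (· ∩ Aₙ) / P D (Aₙ)` with `Aₙ = {γ ⊆ cl Dₙ}` and `P D (Aₙ) → 1` by dominated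
  convergence of indicators);
* `tendsto_integral_of_eventually_rangeSubset` — hence `P Dₙ ⇀ P D` weakly (portmanteau);
* `tendsto_integral_of_compact_exhaustion` — with `IsChordal` and `IsCarriedBySimpleCurves` the
  curve of `P D` a.s. lies in the non-closed set `D ∪ {a, b}` and has compact trace, so it suffices
  that every compact `K ⊆ D ∪ {a, b}` eventually lies in `closure Dₙ` ("`Dₙ` exhausts `D ∪ {a, b}`
  compactly", e.g. `Dₙ ↑ D` agreeing with `D` near the two marks).

Scope of the mechanism (note for the lead). The proviso `P D {γ ⊆ cl Dₙ} → 1` is NOT automatic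
along pinned Radó sequences: for `Dₙ = D ∖ (boundary bump of size εₙ at distance δₙ from a)`,
`εₙ/δₙ` constant, `εₙ → 0`, the boundary loops converge uniformly, so the normalised Riemann maps
converge uniformly on the closed disc (Radó's theorem) and `(Dₙ)` is a pinned-marks instance of the
data of `ChordalFamily.IsRadoContinuous`; but for the (conformally covariant, hence Radó-continuous)
SLE(8/3) family `P D {γ avoids bumpₙ}` tends to the half-plane avoidance probability of a bump of
relative size `ε`, which is `< 1`. There `P Dₙ = P D (· | avoid bumpₙ)` does NOT converge in total
variation, and its weak convergence rests on a different input: the events `{hit bumpₙ}` are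
measurable with respect to the trace inside `B(a, ρₙ)`, `ρₙ → 0`, and decorrelate from every fixed
event as soon as the germ σ-field of the curve at the mark `a` is trivial (reverse martingale
convergence; Blumenthal's 0–1 law for SLE). Nothing in the seven axioms of crux `Rigidity` appears to
supply such a 0–1 law (the `domain` clause of `IsMarkovExtension` compares configurations with equal
remaining set, and for a simple past from `a` the remaining set determines the past, so a kernel may
remember the germ; no bounded Jordan domain is fixed by a dilation, so no zoom-ergodicity at a mark
is available either). So already the pinned-marks case of `stub_axiomsForceRado` needs input beyond
the TV mechanism of this file; in the general case (moved marks, changed boundary germs at the marks)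
no axiom relates the two laws at all (the symmetry group `z ↦ r iᵏ z + w`, `z ↦ z̄` cannot re-align
two generic mark pairs, and Markov/reversal steps only produce curve-generated marks).
-/

noncomputable section

namespace Summit.CriticalPhenomena.SAWScalingLimit.Cruxes.Rigidity.Dichotomy

open MeasureTheory Set Filter Topology
open Literature.Probability.RandomPlanarGeometry
open scoped ENNReal BoundedContinuousFunction

variable {P : ChordalFamily}

/-- **Pinned-marks inner continuity, setwise form.** Let `P` be a chordal family with the
two-sided restriction property, `D` a Dobrushin domain and `Dₙ ⊆ D` Dobrushin domains with the same
marked points, indexed by a countably generated filter `L`. If `P D`-almost every curve eventually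
(along `L`) has its trace in `closure Dₙ`, then `P Dₙ (T) → P D (T)` for every Borel `T`.
Proof: with `Aₙ = {γ ⊆ cl Dₙ}`, restriction gives `P Dₙ (T) · P D (Aₙ) = P D (T ∩ Aₙ)`; the
indicators of `T ∩ Aₙ` converge a.e. to the indicator of `T`, so `P D (T ∩ Aₙ) → P D (T)` and
`P D (Aₙ) → 1` (dominated convergence), whence `P Dₙ (T) = P D (T ∩ Aₙ) / P D (Aₙ) → P D (T)`.
[folklore] -/
theorem tendsto_measure_of_eventually_rangeSubset (hch : P.IsChordal) (hres : P.IsRestriction)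
    {ι : Type*} {L : Filter ι} [L.IsCountablyGenerated] {D : DobrushinDomain}
    {Dn : ι → DobrushinDomain} (hsub : ∀ n, (Dn n).carrier ⊆ D.carrier)
    (h0 : ∀ n, (Dn n).pt 0 = D.pt 0) (h1 : ∀ n, (Dn n).pt 1 = D.pt 1)
    (hev : ∀ᵐ γ ∂(P D), ∀ᶠ n in L, CurveClass.range γ ⊆ closure (Dn n).carrier)
    {T : Set (CurveClass ℂ)} (hT : MeasurableSet T) :
    Tendsto (fun n => P (Dn n) T) L (𝓝 (P D T)) := by
  haveI : ∀ D₀ : DobrushinDomain, IsProbabilityMeasure (P D₀) := fun D₀ => (hch D₀).1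
  set A : ι → Set (CurveClass ℂ) := fun n => CurveClass.rangeSubset (closure (Dn n).carrier)
    with hAdef
  have hAm : ∀ n, MeasurableSet (A n) := fun n =>
    CurveClass.measurableSet_rangeSubset isClosed_closure
  -- numerators: `P D (S ∩ Aₙ) → P D (S)` for every Borel `S`
  have hnum : ∀ S : Set (CurveClass ℂ), MeasurableSet S →
      Tendsto (fun n => P D (S ∩ A n)) L (𝓝 (P D S)) := by
    intro S hS
    refine tendsto_measure_of_ae_tendsto_indicator_of_isFiniteMeasure L hS
      (fun n => hS.inter (hAm n)) ?_
    filter_upwards [hev] with γ hγ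
    filter_upwards [hγ] with n hn
    exact ⟨fun h => h.1, fun h => ⟨h, CurveClass.mem_rangeSubset.2 hn⟩⟩
  -- denominators: `P D (Aₙ) → 1`
  have hden : Tendsto (fun n => P D (A n)) L (𝓝 1) := by
    simpa only [univ_inter, measure_univ] using hnum univ MeasurableSet.univ
  have hpos : ∀ᶠ n in L, P D (A n) ≠ 0 := by
    have h2 : ∀ᶠ n in L, (1 / 2 : ℝ≥0∞) < P D (A n) :=
      hden.eventually (lt_mem_nhds (by norm_num))
    filter_upwards [h2] with n hn
    intro hn0
    rw [hn0] at hn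
    exact ENNReal.not_lt_zero hn
  -- restriction: `P Dₙ (T) = P D (T ∩ Aₙ) / P D (Aₙ)` as soon as the denominator is nonzero
  have heq : ∀ᶠ n in L, P D (T ∩ A n) / P D (A n) = P (Dn n) T := by
    filter_upwards [hpos] with n hn
    refine ((ENNReal.eq_div_iff hn (measure_ne_top _ _)).2 ?_).symm
    rw [mul_comm]
    exact hres D (Dn n) (hsub n) (h0 n) (h1 n) T hT
  have hlim : Tendsto (fun n => P D (T ∩ A n) / P D (A n)) L (𝓝 (P D T)) := by
    have h := ENNReal.Tendsto.div (hnum T hT) (Or.inr one_ne_zero) hden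
      (Or.inl ENNReal.one_ne_top)
    simpa only [div_one] using h
  exact hlim.congr' heq

/-- **Pinned-marks inner continuity, weak form.** Under the hypotheses of
`tendsto_measure_of_eventually_rangeSubset` (chordal restriction family; `Dₙ ⊆ D` with the same
marks; a.e. curve of `P D` eventually inside `closure Dₙ`), `P Dₙ ⇀ P D` weakly:
`∫ f dP(Dₙ) → ∫ f dP(D)` for every bounded continuous real `f` on curve space. Setwise convergence
on open sets is the liminf condition of the portmanteau theorem
(`MeasureTheory.tendsto_of_forall_isOpen_le_liminf'`). This is the instance of Radó continuity
(`ChordalFamily.IsRadoContinuous`) that restriction alone supplies: inner approximation with PINNED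
marks and asymptotically full containment probability. [folklore] -/
theorem tendsto_integral_of_eventually_rangeSubset (hch : P.IsChordal) (hres : P.IsRestriction)
    {ι : Type*} {L : Filter ι} [L.IsCountablyGenerated] {D : DobrushinDomain}
    {Dn : ι → DobrushinDomain} (hsub : ∀ n, (Dn n).carrier ⊆ D.carrier)
    (h0 : ∀ n, (Dn n).pt 0 = D.pt 0) (h1 : ∀ n, (Dn n).pt 1 = D.pt 1)
    (hev : ∀ᵐ γ ∂(P D), ∀ᶠ n in L, CurveClass.range γ ⊆ closure (Dn n).carrier)
    (f : CurveClass ℂ →ᵇ ℝ) :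
    Tendsto (fun n => ∫ γ, f γ ∂(P (Dn n))) L (𝓝 (∫ γ, f γ ∂(P D))) := by
  have hprob : ∀ D₀ : DobrushinDomain, IsProbabilityMeasure (P D₀) := fun D₀ => (hch D₀).1
  rcases L.eq_or_neBot with rfl | hL
  · exact tendsto_bot
  have hweak : Tendsto (β := ProbabilityMeasure (CurveClass ℂ))
      (fun n => ⟨P (Dn n), hprob (Dn n)⟩) L (𝓝 ⟨P D, hprob D⟩) :=
    tendsto_of_forall_isOpen_le_liminf' fun G hG =>
      ((tendsto_measure_of_eventually_rangeSubset hch hres hsub h0 h1 hev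
        hG.measurableSet).liminf_eq).ge
  exact ProbabilityMeasure.tendsto_iff_forall_integral_tendsto.1 hweak f

/-- For a chordal family carried by simple boundary-avoiding curves, `P D`-almost every curve has
its (compact) trace inside the non-closed set `D ∪ {a, b}`: trace in `closure D` (`IsChordal`)
meeting `∂D = closure D ∖ D` only inside `{a, b}` (`IsCarriedBySimpleCurves`). [folklore] -/
theorem ae_range_subset_carrier_union (hch : P.IsChordal) (hS : P.IsCarriedBySimpleCurves)
    (D : DobrushinDomain) :
    ∀ᵐ γ ∂(P D), CurveClass.range γ ⊆ D.carrier ∪ {D.pt 0, D.pt 1} := by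
  filter_upwards [(hch D).2, hS D] with γ hγ hγS
  intro z hz
  by_cases hzD : z ∈ D.carrier
  · exact Or.inl hzD
  · have hfr : z ∈ frontier D.carrier := by
      rw [D.isOpen.frontier_eq]
      exact ⟨hγ.2.2 hz, hzD⟩
    exact Or.inr (hγS.2 ⟨hz, hfr⟩)

/-- **Pinned-marks inner continuity along a compact exhaustion of `D ∪ {a, b}`.** Let `P` be
chordal, with two-sided restriction, carried by simple curves meeting `∂D` only at the marks. If
`Dₙ ⊆ D` are Dobrushin domains with the same marked points such that every compact
`K ⊆ D ∪ {a, b}` eventually lies in `closure Dₙ` (for instance `Dₙ ↑ D` with `Dₙ = D` near the two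
marks), then `P Dₙ ⇀ P D` weakly. The a.e. trace is a compact subset of `D ∪ {a, b}`
(`ae_range_subset_carrier_union`), so it is eventually inside `closure Dₙ` and
`tendsto_integral_of_eventually_rangeSubset` applies. The containment mechanism genuinely stops
here: along some pinned-marks Radó sequences (boundary bumps shrinking into a mark) the containment
probability `P D {γ ⊆ cl Dₙ}` stays bounded away from `1` for the SLE(8/3) family, whose weak
continuity there rests on decorrelation at the mark instead (see the module docstring). [folklore] -/
theorem tendsto_integral_of_compact_exhaustion (hch : P.IsChordal) (hres : P.IsRestriction)
    (hS : P.IsCarriedBySimpleCurves) {ι : Type*} {L : Filter ι} [L.IsCountablyGenerated]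
    {D : DobrushinDomain} {Dn : ι → DobrushinDomain} (hsub : ∀ n, (Dn n).carrier ⊆ D.carrier)
    (h0 : ∀ n, (Dn n).pt 0 = D.pt 0) (h1 : ∀ n, (Dn n).pt 1 = D.pt 1)
    (hK : ∀ K : Set ℂ, IsCompact K → K ⊆ D.carrier ∪ {D.pt 0, D.pt 1} →
      ∀ᶠ n in L, K ⊆ closure (Dn n).carrier)
    (f : CurveClass ℂ →ᵇ ℝ) :
    Tendsto (fun n => ∫ γ, f γ ∂(P (Dn n))) L (𝓝 (∫ γ, f γ ∂(P D))) := by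
  refine tendsto_integral_of_eventually_rangeSubset hch hres hsub h0 h1 ?_ f
  filter_upwards [ae_range_subset_carrier_union hch hS D] with γ hγ
  exact hK γ.range γ.isCompact_range hγ

/-- **Setwise form along a compact exhaustion** (same hypotheses as
`tendsto_integral_of_compact_exhaustion`): `P Dₙ (T) → P D (T)` for every Borel `T` — convergence
in total variation, stronger than the weak convergence Radó continuity asks for. [folklore] -/
theorem tendsto_measure_of_compact_exhaustion (hch : P.IsChordal) (hres : P.IsRestriction)
    (hS : P.IsCarriedBySimpleCurves) {ι : Type*} {L : Filter ι} [L.IsCountablyGenerated]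
    {D : DobrushinDomain} {Dn : ι → DobrushinDomain} (hsub : ∀ n, (Dn n).carrier ⊆ D.carrier)
    (h0 : ∀ n, (Dn n).pt 0 = D.pt 0) (h1 : ∀ n, (Dn n).pt 1 = D.pt 1)
    (hK : ∀ K : Set ℂ, IsCompact K → K ⊆ D.carrier ∪ {D.pt 0, D.pt 1} →
      ∀ᶠ n in L, K ⊆ closure (Dn n).carrier)
    {T : Set (CurveClass ℂ)} (hT : MeasurableSet T) :
    Tendsto (fun n => P (Dn n) T) L (𝓝 (P D T)) := by
  refine tendsto_measure_of_eventually_rangeSubset hch hres hsub h0 h1 ?_ hT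
  filter_upwards [ae_range_subset_carrier_union hch hS D] with γ hγ
  exact hK γ.range γ.isCompact_range hγ

/-- **Registered helper stub `stub_pinnedInnerContinuity` (closed, sequential form of
`tendsto_integral_of_compact_exhaustion`).** For a chordal family with two-sided restriction carried
by simple boundary-avoiding curves, and Dobrushin domains `Dₙ ⊆ D` with the marked points of `D`
such that every compact subset of `D ∪ {a, b}` lies in `closure Dₙ` for all large `n`, the laws
converge weakly: `∫ f dP(Dₙ) → ∫ f dP(D)` for every bounded continuous real `f` — the pinned-marks,
inner-exhaustion instance of the conclusion of `ChordalFamily.IsRadoContinuous`, obtained from the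
axioms of crux `Rigidity` (indeed from H1, H2, H7 alone). [folklore] -/
theorem stub_pinnedInnerContinuity : ∀ P : Literature.Probability.RandomPlanarGeometry.ChordalFamily, P.IsChordal → P.IsRestriction → P.IsCarriedBySimpleCurves → ∀ (D : Literature.Probability.RandomPlanarGeometry.DobrushinDomain) (Dn : ℕ → Literature.Probability.RandomPlanarGeometry.DobrushinDomain), (∀ n, (Dn n).carrier ⊆ D.carrier ∧ (Dn n).pt 0 = D.pt 0 ∧ (Dn n).pt 1 = D.pt 1) → (∀ K : Set ℂ, IsCompact K → K ⊆ D.carrier ∪ {D.pt 0, D.pt 1} → ∃ N : ℕ, ∀ n, N ≤ n → K ⊆ closure (Dn n).carrier) → ∀ f : BoundedContinuousFunction (Literature.Probability.RandomPlanarGeometry.CurveClass ℂ) ℝ, Filter.Tendsto (fun n => ∫ γ, f γ ∂(P (Dn n))) Filter.atTop (nhds (∫ γ, f γ ∂(P D))) := by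
  intro P hch hres hS D Dn hDn hK f
  refine tendsto_integral_of_compact_exhaustion hch hres hS (fun n => (hDn n).1)
    (fun n => (hDn n).2.1) (fun n => (hDn n).2.2) (fun K hKc hKs => ?_) f
  obtain ⟨N, hN⟩ := hK K hKc hKs
  exact eventually_atTop.2 ⟨N, hN⟩

end Summit.CriticalPhenomena.SAWScalingLimit.Cruxes.Rigidity.Dichotomy

end
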